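import Summits.QuantumFields.YangMills.Theorems.WeakCouplingRatesColdBoxChartDict
import Summits.QuantumFields.YangMills.Theorems.WeakCouplingRatesColdBoxChartProduct

/-!
# Crux `BulkDominatesColdBoxW` (stmt-QuantumFields-19609), expansion stubs with a boundary datum: the INVERSE gnomonic chart — every `SU(2)`
# element of positive trace is a chart point `P(1, v)`, with `|v|² ≤ 2·cost` when the cost is `≤ ½`

The one-scale expansion with a crude-good datum writes the (gauge-fixed, small) exterior links of the datum as chart points `gnomonicChart (ϑ_e)`
(critic's STUB-PLAN for `stub_goodBoundaryCovStable`, helper H-T0, «inverse gnomonic chart is ABSENT from the tree»; census v4 trunk R4 written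
for an exterior datum within `r` of `1`).  This file supplies it:

* `gnomonicChart_coordsOf` — for `U ∈ SU(2)` with `0 < Re tr U`, the explicit coordinates `v = im(q)/re(q)` (`q = su2Quat U`) satisfy
  `gnomonicChart v = U` (`quatToSU2_smul`, `quatToSU2_su2Quat`);
* `exists_gnomonicChart_eq_of_trace_pos` — existence form;
* `exists_gnomonicChart_eq_of_cost_le_half` — if the single-link cost `2 − Re tr U ≤ ½` then `U = gnomonicChart v` with `Σ_c v_c² ≤ 2(2 − Re tr U)`
  (`sum_sq_le_two_mul_cost`), the form in which the datum's chart coordinates inherit the crude-good/collar smallness;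
* `gnomonicChart_injective` — the coordinates are unique.

Fleet seat `ym-spine-20043-p1` (g3; work split with the line lead `ym-wcr-19609-p1`).  No sorry, standard axioms, no new definition, no named-fact
hypothesis.  NOT a claim about the mass gap.
-/

set_option autoImplicit false

noncomputable section

open Quaternion Finset
open Literature.MathematicalPhysics.QuantumLattice
open Literature.MathematicalPhysics.QuantumFieldTheory

namespace Summit.QuantumFields.YangMills.Theorems.WeakCouplingRates

/-- **Explicit inverse chart**: for `U ∈ SU(2)` with `0 < Re tr U` and `q = su2Quat U`, the coordinates `v = (q.imI, q.imJ, q.imK)/q.re`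
satisfy `gnomonicChart v = U`. -/
theorem gnomonicChart_coordsOf (U : Matrix.specialUnitaryGroup (Fin 2) ℂ) (hU : 0 < ((U : Matrix (Fin 2) (Fin 2) ℂ).trace).re) :
    gnomonicChart ![(su2Quat U).imI / (su2Quat U).re, (su2Quat U).imJ / (su2Quat U).re, (su2Quat U).imK / (su2Quat U).re] = U := by
  set q := su2Quat U with hq
  have hre : 0 < q.re := by
    -- `Re tr U = 2·re(su2Quat U)` (also `…NE7b.SU2QuaternionBridge.re_trace_su2_eq_two_mul_re` in the BalabanUV tree)
    have h : ((U : Matrix (Fin 2) (Fin 2) ℂ).trace).re = 2 * q.re := by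
      rw [hq, ← quatMatrix_su2Quat U, trace_quatMatrix_re]
    linarith
  have hg : gnomonicQuat ![q.imI / q.re, q.imJ / q.re, q.imK / q.re] = q.re⁻¹ • q := by
    ext <;> simp [gnomonicQuat, Quaternion.re_smul, Quaternion.imI_smul, Quaternion.imJ_smul, Quaternion.imK_smul,
      div_eq_inv_mul, hre.ne']
  rw [gnomonicChart, hg, quatToSU2_smul (inv_pos.2 hre), hq, quatToSU2_su2Quat]

/-- **Every `SU(2)` element of positive trace is a gnomonic chart point.** -/
theorem exists_gnomonicChart_eq_of_trace_pos (U : Matrix.specialUnitaryGroup (Fin 2) ℂ)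
    (hU : 0 < ((U : Matrix (Fin 2) (Fin 2) ℂ).trace).re) : ∃ v : Fin 3 → ℝ, gnomonicChart v = U :=
  ⟨_, gnomonicChart_coordsOf U hU⟩

/-- **Inverse chart with size control**: if the single-link Wilson cost of `U ∈ SU(2)` is at most `½`, then `U = gnomonicChart v` with
`Σ_c v_c² ≤ 2·(2 − Re tr U)`. -/
theorem exists_gnomonicChart_eq_of_cost_le_half (U : Matrix.specialUnitaryGroup (Fin 2) ℂ)
    (hc : 2 - ((U : Matrix (Fin 2) (Fin 2) ℂ).trace).re ≤ 1 / 2) :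
    ∃ v : Fin 3 → ℝ, gnomonicChart v = U ∧ ∑ c, v c ^ 2 ≤ 2 * (2 - ((U : Matrix (Fin 2) (Fin 2) ℂ).trace).re) := by
  have hU : 0 < ((U : Matrix (Fin 2) (Fin 2) ℂ).trace).re := by linarith
  obtain ⟨v, hv⟩ := exists_gnomonicChart_eq_of_trace_pos U hU
  refine ⟨v, hv, ?_⟩
  have h := sum_sq_le_two_mul_cost (v := v) (by rw [← gnomonicChart, hv]; exact hc)
  rw [← gnomonicChart, hv] at h
  exact h

/-- **Uniform form for an edge field**: if every link of `U` on a set of edges `S` has cost `≤ c ≤ ½`, there is a chart field `v` with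
`U e = gnomonicChart (v e)` and `Σ_c (v e)_c² ≤ 2c` on `S` (and `v e = 0` off `S`). -/
theorem exists_chart_field_of_cost_le {ι : Type*} (S : Set ι) [DecidablePred (· ∈ S)]
    (U : ι → Matrix.specialUnitaryGroup (Fin 2) ℂ) {c : ℝ} (hc : c ≤ 1 / 2)
    (hU : ∀ e ∈ S, 2 - ((U e : Matrix (Fin 2) (Fin 2) ℂ).trace).re ≤ c) :
    ∃ v : ι → (Fin 3 → ℝ), (∀ e ∈ S, gnomonicChart (v e) = U e ∧ ∑ k, v e k ^ 2 ≤ 2 * c) ∧ ∀ e ∉ S, v e = 0 := by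
  classical
  have hex : ∀ e ∈ S, ∃ w : Fin 3 → ℝ, gnomonicChart w = U e ∧ ∑ k, w k ^ 2 ≤ 2 * c := by
    intro e he
    obtain ⟨w, hw, hs⟩ := exists_gnomonicChart_eq_of_cost_le_half (U e) ((hU e he).trans hc)
    exact ⟨w, hw, hs.trans (by linarith [hU e he])⟩
  refine ⟨fun e => if he : e ∈ S then (hex e he).choose else 0, fun e he => ?_, fun e he => by simp [he]⟩
  simp only [he, dif_pos]
  exact (hex e he).choose_spec

/-- The gnomonic chart is injective. -/
theorem gnomonicChart_injective : Function.Injective gnomonicChart := by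
  intro v w h
  have hq : ∀ u : Fin 3 → ℝ, su2Quat (gnomonicChart u) = ‖gnomonicQuat u‖⁻¹ • gnomonicQuat u := fun u =>
    Balaban1983to89.T4HaarSU2Translate.su2Quat_quatToSU2 (gnomonicQuat_ne_zero u)
  have h1 := hq v
  have h2 := hq w
  rw [h] at h1
  rw [h1] at h2
  -- compare real parts to identify the scalars, then the imaginary parts
  have hre : ‖gnomonicQuat w‖⁻¹ = ‖gnomonicQuat v‖⁻¹ := by
    have := congrArg (fun x : ℍ => x.re) h2
    simpa [gnomonicQuat, Quaternion.re_smul] using this.symm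
  rw [hre] at h2
  have hpos : 0 < ‖gnomonicQuat v‖⁻¹ := inv_pos.2 (norm_gnomonicQuat_pos v)
  have h3 : gnomonicQuat v = gnomonicQuat w := smul_right_injective ℍ hpos.ne' h2
  funext i
  have hI := congrArg (fun x : ℍ => x.imI) h3
  have hJ := congrArg (fun x : ℍ => x.imJ) h3
  have hK := congrArg (fun x : ℍ => x.imK) h3
  simp only [gnomonicQuat] at hI hJ hK
  fin_cases i
  · exact hI
  · exact hJ
  · exact hK

end Summit.QuantumFields.YangMills.Theorems.WeakCouplingRates

end
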